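import Summits.QuantumFields.QCD.Theorems.QuarksAsStableActionStableActionBridgeFermionSlicePosDef
import Summits.QuantumFields.QCD.Theorems.QuarksAsStableActionStableActionBridgeFermionSliceContinuous
import Summits.QuantumFields.QCD.Theorems.QuarksAsStableActionStableActionBridgeCoreFermionStep
import Summits.QuantumFields.QCD.Theorems.QuarksAsStableActionStableActionBridgeSliceGaugeUnitarity
import Mathlib.Analysis.CStarAlgebra.ContinuousFunctionalCalculus.Continuity
import Mathlib.Analysis.Matrix.Order
import Mathlib.Analysis.SpecialFunctions.ContinuousFunctionalCalculus.Rpow.Basic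

/-!
# The positive square root `T̂_F(U)^{1/2}` of the fermionic transfer operator
(crux `HeatSlicedQuarks.RobustYangMillsHandover`, item stmt-QuantumFields-8892, line `pin-the-infimum`;
registered sub-goal `fermionSliceOp_sqrt_exists`, `--supports stmt-QuantumFields-8892`)

Smit (*Introduction to Quantum Fields on a Lattice*, §6.5 (6.87)) writes the transfer operator of lattice
QCD with `r = 1` Wilson quarks as `T̂ = T̂_F^{1/2} T̂_U T̂_F^{1/2}`, with `T̂_F(U) = fermionSliceOp U mq`
Lüscher's fermionic one-step transfer operator in the background `U ∈ SU(3)^{Edge 3 S}`, a Hermitian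
positive definite matrix on the slice Fock space for all bare masses `m_f > −1` (`fermionSliceOp_posDef`).
The operator realisation of the min–max levels `qcdTransferLevel` on `L²(sliceHaar) ⊗ Fock` needs the
fibrewise positive square root `R(U) = T̂_F(U)^{1/2}` with four properties, delivered here as ONE existence
statement `fermionSliceOp_sqrt_exists` (no definition is introduced; `R U := CFC.sqrt (T̂_F(U))`, Mathlib's
continuous-functional-calculus square root of a non-negative matrix, scoped order `MatrixOrder`):

* `R` is continuous in `U`: `U ↦ T̂_F(U)` is continuous (`continuous_fermionSliceOp`) with non-negative
  values, and the continuous functional calculus `a ↦ cfc √· a` is continuous on non-negative elements of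
  the C⋆-algebra `Matrix _ _ ℂ` (L²-operator norm, scoped `Matrix.Norms.L2Operator`, whose topology is the
  product topology; Mathlib's `Continuous.cfc_nnreal_of_mem_nhdsSet`);
* `R(U)` is positive definite (`IsStrictlyPositive.sqrt`), hence Hermitian;
* `R(U)² = T̂_F(U)` (`CFC.sqrt_mul_sqrt_self`);
* gauge covariance `R(U^g) = Γ(G_g) R(U) Γ(G_g)ᴴ`: from `T̂_F(U^g) = Γ T̂_F(U) Γᴴ`
  (`fermionSliceOp_gaugeTransform'`), unitarity `Γᴴ Γ = 1` (`fockGaugeAct_conjTranspose_mul_self`) and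
  uniqueness of the non-negative square root (`CFC.sqrt_unique`): `(Γ R Γᴴ)² = Γ R² Γᴴ = Γ T̂_F Γᴴ` and
  `Γ R Γᴴ ≥ 0`.

References: J. Smit, *Introduction to Quantum Fields on a Lattice*, §6.5 (6.87) [Smit2023];
M. Lüscher, Commun. Math. Phys. 54 (1977) 283 [Luscher1977, pp. 283–292].  Pure theorem file
(no definitions); the two generic matrix lemmas are exposed in the sub-namespace `FermionSliceSqrt`.
-/

noncomputable section

namespace Summit.QuantumFields.QCD.Cruxes.RobustYangMillsHandover.PinTheInfimum

open MeasureTheory Matrix Literature.MathematicalPhysics.QuantumFieldTheory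
  Literature.MathematicalPhysics.QuantumLattice
open Literature.Probability.LatticeModels (TorusSite)
open Summit.QuantumFields.QCD.Cruxes.StableActionBridge.Sketch
open scoped ComplexOrder MatrixOrder

namespace FermionSliceSqrt

/-- **The square root is continuous on non-negative matrices, along a continuous family**: if
`x ↦ T(x)` is a continuous family of positive semidefinite complex matrices then `x ↦ T(x)^{1/2}`
(`CFC.sqrt`) is continuous.  The continuous functional calculus of the C⋆-algebra `Matrix n n ℂ`
(L²-operator norm, whose topology is the entrywise one) is continuous in the operator variable on
non-negative elements for a function continuous on a neighbourhood (`Set.univ`) of all the spectra.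
[folklore] -/
theorem continuous_cfcSqrt {X : Type*} [TopologicalSpace X] {n : Type*} [Fintype n] [DecidableEq n]
    {T : X → Matrix n n ℂ} (hT : Continuous T) (hpsd : ∀ x, (T x).PosSemidef) :
    Continuous fun x => CFC.sqrt (T x) := by
  rw [show (fun x => CFC.sqrt (T x)) = fun x => cfc NNReal.sqrt (T x) from
    funext fun x => CFC.sqrt_eq_cfc]
  open scoped Matrix.Norms.L2Operator in
  exact Continuous.cfc_nnreal_of_mem_nhdsSet (s := Set.univ) NNReal.sqrt Filter.univ_mem hT
    (fun x => (hpsd x).nonneg) NNReal.continuous_sqrt.continuousOn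

/-- **Unitary covariance of the positive square root**: for a positive semidefinite `A` and an
isometry `V` (`Vᴴ V = 1`), `(V A Vᴴ)^{1/2} = V A^{1/2} Vᴴ` — by uniqueness of the non-negative square
root, since `(V A^{1/2} Vᴴ)² = V A^{1/2} (Vᴴ V) A^{1/2} Vᴴ = V A Vᴴ` and `V A^{1/2} Vᴴ ≥ 0`. [folklore] -/
theorem cfcSqrt_conj {n : Type*} [Fintype n] [DecidableEq n] {A V : Matrix n n ℂ}
    (hA : A.PosSemidef) (hV : Vᴴ * V = 1) :
    CFC.sqrt (V * A * Vᴴ) = V * CFC.sqrt A * Vᴴ := by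
  have hR : (CFC.sqrt A).PosSemidef := (CFC.sqrt_nonneg A).posSemidef
  refine CFC.sqrt_unique ?_ (hR.mul_mul_conjTranspose_same V).nonneg
  have h : V * CFC.sqrt A * Vᴴ * (V * CFC.sqrt A * Vᴴ) =
      V * (CFC.sqrt A * (Vᴴ * V) * CFC.sqrt A) * Vᴴ := by
    simp only [Matrix.mul_assoc]
  rw [h, hV, Matrix.mul_one, CFC.sqrt_mul_sqrt_self A hA.nonneg]

end FermionSliceSqrt

/-- **Registered sub-goal `fermionSliceOp_sqrt_exists` of line `pin-the-infimum`: the positive square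
root `R(U) = T̂_F(U)^{1/2}` of Lüscher's fermionic transfer operator** (the factor of Smit's
`T̂ = T̂_F^{1/2} T̂_U T̂_F^{1/2}`).  For all bare masses `m_f > −1` there is a map `R` from the
`SU(3)` backgrounds of the spatial three-torus to the matrices on the slice Fock space which is
continuous in `U`, positive definite (hence Hermitian) at every `U`, squares to
`T̂_F(U) = fermionSliceOp U mq`, and is gauge covariant, `R(U^g) = Γ(G_g) R(U) Γ(G_g)ᴴ`.
Witness: `R U := CFC.sqrt (fermionSliceOp U mq)`; continuity by `FermionSliceSqrt.continuous_cfcSqrt`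
and `continuous_fermionSliceOp`, positivity by `fermionSliceOp_posDef` and `IsStrictlyPositive.sqrt`,
covariance by `fermionSliceOp_gaugeTransform'`, `fockGaugeAct_conjTranspose_mul_self` and
`FermionSliceSqrt.cfcSqrt_conj`. [cite: Smit2023, §6.5 (6.87)] -/
theorem fermionSliceOp_sqrt_exists : ∀ (Nf S : ℕ) [NeZero S] (mq : Fin Nf → ℝ), (∀ f, -1 < mq f) →
    ∃ R : GaugeConfig 3 S (Matrix.specialUnitaryGroup (Fin 3) ℂ) →
        Matrix (Finset (SliceFermiIdx Nf S)) (Finset (SliceFermiIdx Nf S)) ℂ,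
      Continuous R ∧ (∀ U, (R U).PosDef) ∧ (∀ U, (R U)ᴴ = R U) ∧ (∀ U, R U * R U = fermionSliceOp U mq) ∧
        ∀ (g : TorusSite 3 S → Matrix.specialUnitaryGroup (Fin 3) ℂ)
          (U : GaugeConfig 3 S (Matrix.specialUnitaryGroup (Fin 3) ℂ)),
          R (gaugeTransform g U) = fockGaugeAct g * R U * (fockGaugeAct g)ᴴ := by
  intro Nf S _ mq hm
  have hT : ∀ U : GaugeConfig 3 S (Matrix.specialUnitaryGroup (Fin 3) ℂ),
      (fermionSliceOp U mq).PosDef := fun U => fermionSliceOp_posDef Nf S U mq hm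
  have hR : ∀ U : GaugeConfig 3 S (Matrix.specialUnitaryGroup (Fin 3) ℂ),
      (CFC.sqrt (fermionSliceOp U mq)).PosDef := fun U =>
    (IsStrictlyPositive.sqrt _ (hT U).isStrictlyPositive).posDef
  refine ⟨fun U => CFC.sqrt (fermionSliceOp U mq), ?_, hR, fun U => (hR U).isHermitian,
    fun U => CFC.sqrt_mul_sqrt_self _ (hT U).posSemidef.nonneg, fun g U => ?_⟩
  · exact FermionSliceSqrt.continuous_cfcSqrt (continuous_fermionSliceOp Nf S mq hm)
      fun U => (hT U).posSemidef
  · show CFC.sqrt (fermionSliceOp (gaugeTransform g U) mq) =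
      fockGaugeAct g * CFC.sqrt (fermionSliceOp U mq) * (fockGaugeAct g)ᴴ
    rw [fermionSliceOp_gaugeTransform' g U mq]
    exact FermionSliceSqrt.cfcSqrt_conj (hT U).posSemidef (fockGaugeAct_conjTranspose_mul_self Nf S g).1

end Summit.QuantumFields.QCD.Cruxes.RobustYangMillsHandover.PinTheInfimum

end
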